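import Mathlib
import HarnessLib
import Literature.Analysis.FluidPDE.LocalTypeICongr
import Literature.Analysis.FluidPDE.LocalTypeILiouville
import Literature.Analysis.FluidPDE.TypeIRateOseenMildRepresentative
import Literature.Analysis.FluidPDE.NSBoundedMildOseenClassical
import Summits.NavierStokesRegularity.NavierStokesRegularity.Theorems.RellichScarTypeIBlowupProfileZoomLimit
import Summits.NavierStokesRegularity.NavierStokesRegularity.Theorems.LocalSineTubeDoorProfileAlignedWindowRigidityAncient

/-!
# Route `LocalSineTubeDoor`, crux `LocalPointZoom` (stmt-NavierStokesRegularity-20017) —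
# support file 2: the LOCAL Type-I rate passes to the zoom-in limit; the profile representative

Cell ns-regularity-ideate, seat p6 (route-directed support, `--supports stmt-NavierStokesRegularity-20017`).
Local replacements of two steps of the cell's global chain (`Cell.NsRegP1c.treeZoomFrame`, Sketch8A):

* `norm_nsZoom_le_rate_of_ball`, `ae_rate_of_zoomLimit_of_ball` — the tree's `norm_nsZoom_le_rate` /
  `ae_rate_of_zoomLimit` (`Theorems.RellichScarTypeIBlowupProfileZoomLimit`) with the rate hypothesis
  `‖v(s,y)‖ ≤ C/√(−s)` assumed only for `‖y‖ < ρ₁` (a LOCALLY Type I point): since the zoom-in scales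
  `λⱼ → 0⁺`, on each `Q(0,a)` the approximants `λⱼ v(λⱼ² s, λⱼ y)` eventually obey the bound pointwise, and a
  subsequence converges a.e., so the `L³_loc` limit obeys it a.e. on the whole slab `ℝ₋ × ℝ³`;
* `exists_profile_repr` — (P) the Albritton–Barker-class Type-I-rate slab profile with a backward-singular
  origin has an a.e.-representative in the ROUTE's profile class (Type-I rate, continuous on the open slab,
  unit-viscosity Oseen-mild between negative times, divergence-free slices) with a backward-singular origin
  (tree `exists_rate_profile_repr`, `exists_oseenMild_repr_of_typeIBound_lt_top`,
  `IsBackwardSingularPoint.congr_ae`; weak ⇒ classical divergence-freeness through slice analyticity,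
  `Theorems.LocalSineTubeDoorProfileAlignedWindowRigidityAncient.analyticOnNhd_slice`).

Sources: Albritton–Barker 2019 (arXiv:1811.00502) §3; KNSS 2009 (arXiv:0709.3599) (1.4), §4.
WHAT THIS IS NOT: not a claim about Navier–Stokes regularity; support lemmas for an OPEN crux of a DRAFT route.
-/

noncomputable section

namespace Summit.NavierStokesRegularity.NavierStokesRegularity.Theorems.LocalSineTubeDoorLocalPointZoomRate

open MeasureTheory Set Function Filter Topology TopologicalSpace Metric
open Literature.Analysis Literature.Analysis.FluidPDE
open Summit.NavierStokesRegularity.NavierStokesRegularity.Theorems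
open Summit.NavierStokesRegularity.NavierStokesRegularity.Theorems.LocalSineTubeDoorProfileAlignedWindowRigidityAncient
open scoped NNReal ENNReal

/-- **The local Type-I rate under the Navier–Stokes zoom about the origin.** If `‖v(s, y)‖ ≤ C/√(−s)` for
`−δ₁ < s < 0` and `‖y‖ < ρ₁`, then the zoom `v_c(s, y) = c v(c² s, c y)`, `c > 0`, satisfies the same bound for
`−δ₁/c² < s < 0` and `‖y‖ < ρ₁ / c`. -/
theorem norm_nsZoom_le_rate_of_ball {v : ℝ → EuclideanSpace ℝ (Fin 3) → EuclideanSpace ℝ (Fin 3)}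
    {C δ₁ ρ₁ c : ℝ} (hc : 0 < c)
    (hrate : ∀ s ∈ Ioo (-δ₁) 0, ∀ y ∈ ball (0 : EuclideanSpace ℝ (Fin 3)) ρ₁, ‖v s y‖ ≤ C / Real.sqrt (-s))
    {s : ℝ} (hs : s ∈ Ioo (-(δ₁ / c ^ 2)) 0) {y : EuclideanSpace ℝ (Fin 3)}
    (hy : y ∈ ball (0 : EuclideanSpace ℝ (Fin 3)) (ρ₁ / c)) :
    ‖(c • stPull (c ^ 2) c (0 : ℝ) (0 : EuclideanSpace ℝ (Fin 3)) v) s y‖ ≤ C / Real.sqrt (-s) := by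
  have hc2 : 0 < c ^ 2 := pow_pos hc 2
  have hs1 : -δ₁ < c ^ 2 * s := by
    have h := mul_lt_mul_of_pos_left hs.1 hc2
    rwa [mul_neg, mul_div_cancel₀ _ hc2.ne'] at h
  have hs2 : c ^ 2 * s < 0 := mul_neg_of_pos_of_neg hc2 hs.2
  have hcy : c • y ∈ ball (0 : EuclideanSpace ℝ (Fin 3)) ρ₁ := by
    rw [mem_ball_zero_iff] at hy ⊢
    rw [norm_smul, Real.norm_of_nonneg hc.le]
    calc c * ‖y‖ < c * (ρ₁ / c) := mul_lt_mul_of_pos_left hy hc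
      _ = ρ₁ := mul_div_cancel₀ ρ₁ hc.ne'
  have hb := hrate (c ^ 2 * s) ⟨hs1, hs2⟩ (c • y) hcy
  have hsq : Real.sqrt (-(c ^ 2 * s)) = c * Real.sqrt (-s) := by
    rw [show -(c ^ 2 * s) = c ^ 2 * (-s) by ring, Real.sqrt_mul hc2.le, Real.sqrt_sq hc.le]
  rw [hsq] at hb
  have hpos : 0 < Real.sqrt (-s) := Real.sqrt_pos.2 (by linarith [hs.2])
  rw [smul_stPull_apply, zero_add, zero_add, norm_smul, Real.norm_of_nonneg hc.le]
  calc c * ‖v (c ^ 2 * s) (c • y)‖ ≤ c * (C / (c * Real.sqrt (-s))) :=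
        mul_le_mul_of_nonneg_left hb hc.le
    _ = C / Real.sqrt (-s) := by field_simp

/-- **The LOCAL Type-I rate passes to the zoom-in limit, almost everywhere on the slab.** If
`‖v(s, y)‖ ≤ C/√(−s)` for `−δ₁ < s < 0` and `‖y‖ < ρ₁` only, and the zooms `λⱼ v(λⱼ² s, λⱼ y)`, `λⱼ → 0⁺`,
converge to `w` in `L³(Q(0, a))` for every `a > 0`, then `‖w(s, y)‖ ≤ C/√(−s)` for a.e. `(s, y) ∈ ℝ₋ × ℝ³`
(on each `Q(0, a)` the approximants eventually obey the bound pointwise — the rate region `‖y‖ < ρ₁/λⱼ`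
exhausts `ℝ³` — and a subsequence converges a.e.).  Local version of the tree's `ae_rate_of_zoomLimit`. -/
theorem ae_rate_of_zoomLimit_of_ball {v w : ℝ → EuclideanSpace ℝ (Fin 3) → EuclideanSpace ℝ (Fin 3)}
    {C δ₁ ρ₁ : ℝ} (hδ₁ : 0 < δ₁) (hρ₁ : 0 < ρ₁)
    (hrate : ∀ s ∈ Ioo (-δ₁) 0, ∀ y ∈ ball (0 : EuclideanSpace ℝ (Fin 3)) ρ₁, ‖v s y‖ ≤ C / Real.sqrt (-s))
    {lam : ℕ → ℝ} (hlam : ∀ j, 0 < lam j) (hlam0 : Tendsto lam atTop (𝓝 0))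
    (hvm : ∀ a : ℝ, 0 < a → ∀ᶠ j in atTop, AEStronglyMeasurable
      (uncurry ((lam j) • stPull ((lam j) ^ 2) (lam j) (0 : ℝ) (0 : EuclideanSpace ℝ (Fin 3)) v))
      (volume.restrict (parabolicCylinder a (0 : ℝ × EuclideanSpace ℝ (Fin 3)))))
    (hlim : ∀ a : ℝ, 0 < a →
      AEStronglyMeasurable (uncurry w)
        (volume.restrict (parabolicCylinder a (0 : ℝ × EuclideanSpace ℝ (Fin 3)))) ∧
      Tendsto (fun j => eLpNorm
          (uncurry ((lam j) • stPull ((lam j) ^ 2) (lam j) (0 : ℝ)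
            (0 : EuclideanSpace ℝ (Fin 3)) v) - uncurry w) 3
          (volume.restrict (parabolicCylinder a (0 : ℝ × EuclideanSpace ℝ (Fin 3)))))
        atTop (𝓝 0)) :
    ∀ᵐ z ∂(volume.restrict (Iio (0 : ℝ) ×ˢ (univ : Set (EuclideanSpace ℝ (Fin 3))))),
      ‖w z.1 z.2‖ ≤ C / Real.sqrt (-z.1) := by
  -- reduce to the exhausting balls `Q(0, n + 1)`
  have hcover : Iio (0 : ℝ) ×ˢ (univ : Set (EuclideanSpace ℝ (Fin 3))) ⊆
      ⋃ n : ℕ, parabolicCylinder ((n : ℝ) + 1) (0 : ℝ × EuclideanSpace ℝ (Fin 3)) := by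
    rintro ⟨s, y⟩ ⟨hs, -⟩
    obtain ⟨n, hn⟩ := exists_nat_ge (max (-s) ‖y‖)
    have h1 : -s ≤ n := (le_max_left _ _).trans hn
    have h2 : ‖y‖ ≤ n := (le_max_right _ _).trans hn
    have hs' : s < 0 := hs
    refine mem_iUnion.2 ⟨n, ?_⟩
    rw [SuitableCompactness.mem_parabolicCylinder_zero]
    refine ⟨⟨?_, hs'⟩, by simp only; linarith⟩
    have h3 : (n : ℝ) + 1 ≤ ((n : ℝ) + 1) ^ 2 := by nlinarith [n.cast_nonneg (α := ℝ)]
    simp only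
    linarith
  refine ae_restrict_of_ae_restrict_of_subset hcover ?_
  rw [ae_restrict_iUnion_iff]
  intro n
  set a : ℝ := (n : ℝ) + 1 with ha
  have ha0 : 0 < a := by positivity
  set Q₀ : Set (ℝ × EuclideanSpace ℝ (Fin 3)) :=
    parabolicCylinder a (0 : ℝ × EuclideanSpace ℝ (Fin 3)) with hQ₀
  obtain ⟨hwm, hconv⟩ := hlim a ha0
  -- eventually: measurable, the scale is below `√δ₁ / a` and below `ρ₁ / a`
  have hev1 : ∀ᶠ j in atTop, lam j < Real.sqrt δ₁ / a :=
    hlam0 (Iio_mem_nhds (div_pos (Real.sqrt_pos.2 hδ₁) ha0))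
  have hev2 : ∀ᶠ j in atTop, lam j < ρ₁ / a := hlam0 (Iio_mem_nhds (div_pos hρ₁ ha0))
  obtain ⟨J, hJ⟩ := eventually_atTop.1 ((hvm a ha0).and (hev1.and hev2))
  have hconv' : Tendsto (fun j => eLpNorm
      (uncurry ((lam (j + J)) • stPull ((lam (j + J)) ^ 2) (lam (j + J)) (0 : ℝ)
        (0 : EuclideanSpace ℝ (Fin 3)) v) - uncurry w) 3 (volume.restrict Q₀)) atTop (𝓝 0) :=
    hconv.comp (tendsto_add_atTop_nat J)
  have hmeasJ : ∀ j, AEStronglyMeasurable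
      (uncurry ((lam (j + J)) • stPull ((lam (j + J)) ^ 2) (lam (j + J)) (0 : ℝ)
        (0 : EuclideanSpace ℝ (Fin 3)) v)) (volume.restrict Q₀) := fun j =>
    (hJ (j + J) (Nat.le_add_left J j)).1
  have hTIM : TendstoInMeasure (volume.restrict Q₀)
      (fun j => uncurry ((lam (j + J)) • stPull ((lam (j + J)) ^ 2) (lam (j + J)) (0 : ℝ)
        (0 : EuclideanSpace ℝ (Fin 3)) v)) atTop (uncurry w) :=
    tendstoInMeasure_of_tendsto_eLpNorm (by norm_num) hmeasJ hwm hconv'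
  obtain ⟨ns, -, hae⟩ := hTIM.exists_seq_tendsto_ae
  -- the approximants obey the rate pointwise on `Q₀`
  have hptw : ∀ j, ∀ z ∈ Q₀, ‖uncurry ((lam (j + J)) • stPull ((lam (j + J)) ^ 2) (lam (j + J))
      (0 : ℝ) (0 : EuclideanSpace ℝ (Fin 3)) v) z‖ ≤ C / Real.sqrt (-z.1) := by
    intro j z hz
    obtain ⟨s, y⟩ := z
    rw [hQ₀, SuitableCompactness.mem_parabolicCylinder_zero] at hz
    have hμ : 0 < lam (j + J) := hlam _
    have hμa : lam (j + J) < Real.sqrt δ₁ / a := (hJ (j + J) (Nat.le_add_left J j)).2.1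
    have hμb : lam (j + J) < ρ₁ / a := (hJ (j + J) (Nat.le_add_left J j)).2.2
    have h1 : lam (j + J) * a < Real.sqrt δ₁ := by rwa [lt_div_iff₀ ha0] at hμa
    have h2 : (lam (j + J)) ^ 2 * a ^ 2 < δ₁ := by
      have h3 : (lam (j + J) * a) ^ 2 < (Real.sqrt δ₁) ^ 2 :=
        pow_lt_pow_left₀ h1 (by positivity) two_ne_zero
      rwa [mul_pow, Real.sq_sqrt hδ₁.le] at h3
    have hs : s ∈ Ioo (-(δ₁ / (lam (j + J)) ^ 2)) 0 := by
      refine ⟨?_, hz.1.2⟩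
      rw [neg_lt, lt_div_iff₀ (pow_pos hμ 2)]
      have := hz.1.1
      simp only at this
      nlinarith [pow_pos hμ 2]
    have hy : y ∈ ball (0 : EuclideanSpace ℝ (Fin 3)) (ρ₁ / lam (j + J)) := by
      rw [mem_ball_zero_iff, lt_div_iff₀ hμ]
      have hya : ‖y‖ < a := by simpa using hz.2
      have h4 : lam (j + J) * a < ρ₁ := by rwa [lt_div_iff₀ ha0] at hμb
      nlinarith [norm_nonneg y]
    exact norm_nsZoom_le_rate_of_ball hμ hrate hs hy
  -- pass to the a.e. limit along `ns`
  filter_upwards [hae, ae_restrict_mem (isOpen_parabolicCylinder a _).measurableSet] with z hz hzQ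
  exact le_of_tendsto hz.norm (Eventually.of_forall fun k => hptw (ns k) z hzQ)

/-- **(P) a representative in the route's profile class.** An Albritton–Barker-class suitable weak
solution `(u, p)` of the unit-viscosity system on the backward slab `ℝ³ × ℝ₋` with weak gradient `G`,
`𝐈(ℝ³ × ℝ₋) < ∞`, a backward-singular origin and the Type-I rate `‖u(s,y)‖ ≤ C/√(−s)` a.e. has an
a.e.-equal representative `v` with the rate POINTWISE, continuous on the open slab, unit-viscosity Oseen-mild
between any two negative times, with divergence-free slices and a backward-singular origin (tree
`exists_rate_profile_repr` + `exists_oseenMild_repr_of_typeIBound_lt_top`; weak ⇒ classical divergence-freeness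
by slice analyticity). -/
theorem exists_profile_repr {u : ℝ → EuclideanSpace ℝ (Fin 3) → EuclideanSpace ℝ (Fin 3)}
    {p : ℝ → EuclideanSpace ℝ (Fin 3) → ℝ}
    {G : ℝ → EuclideanSpace ℝ (Fin 3) → EuclideanSpace ℝ (Fin 3) →L[ℝ] EuclideanSpace ℝ (Fin 3)} {C : ℝ}
    (hC : 0 ≤ C)
    (hsw : IsSuitableWeakSolutionOn (slab (EuclideanSpace ℝ (Fin 3)) (Iio 0) isOpen_Iio) 1 0 u p)
    (hwg : HasWeakSpatialGradientOn (slab (EuclideanSpace ℝ (Fin 3)) (Iio 0) isOpen_Iio) u G)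
    (hI : typeIBound (Iio (0 : ℝ) ×ˢ (univ : Set (EuclideanSpace ℝ (Fin 3)))) u p G < ⊤)
    (hsing : IsBackwardSingularPoint u 0)
    (hrate : ∀ᵐ w ∂(volume.restrict (Iio (0 : ℝ) ×ˢ (univ : Set (EuclideanSpace ℝ (Fin 3))))),
      ‖u w.1 w.2‖ ≤ C / Real.sqrt (-w.1)) :
    ∃ v : ℝ → EuclideanSpace ℝ (Fin 3) → EuclideanSpace ℝ (Fin 3),
      (∀ᵐ w ∂(volume.restrict (Iio (0 : ℝ) ×ˢ (univ : Set (EuclideanSpace ℝ (Fin 3))))),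
        uncurry u w = uncurry v w) ∧
      (HasTypeITimeDecay C v ∧ ContinuousOn (uncurry v) (Iio (0 : ℝ) ×ˢ univ) ∧
        (∀ s t : ℝ, s < t → t < 0 → ∀ x,
          v t x = UnboundedOperators.heatExtension (v s) (t - s) x - oseenDuhamel 1 s v v t x) ∧
        (∀ t < 0, VectorCalculus.IsDivFree (v t))) ∧
      IsBackwardSingularPoint v 0 := by
  obtain ⟨u', hae1, hsw', -, hI', hdec', hsing'⟩ := exists_rate_profile_repr hC hsw hwg hI hsing hrate
  obtain ⟨v, hae2, hcont, hwd, hmild, hratev⟩ := exists_oseenMild_repr_of_typeIBound_lt_top hsw' hdec' hI'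
  have hdiv : ∀ t < 0, VectorCalculus.IsDivFree (v t) := by
    intro t ht
    have hslice : AnalyticOnNhd ℝ (v t) univ :=
      analyticOnNhd_slice hcont (bdd_of_hasTypeITimeDecay hratev) hmild ht
    have hcd : ContDiff ℝ 1 (v t) := contDiffOn_univ.1 (hslice.contDiffOn (n := 1) uniqueDiffOn_univ)
    exact (hwd t ht).isDivFree_of_contDiff hcd
  refine ⟨v, ?_, ⟨hratev, hcont, hmild, hdiv⟩,
    hsing'.congr_ae (fun r _ => parabolicCylinder_origin_subset_slab r) hae2⟩
  filter_upwards [hae1, hae2] with w h1 h2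
  rw [h1, h2]

end Summit.NavierStokesRegularity.NavierStokesRegularity.Theorems.LocalSineTubeDoorLocalPointZoomRate

end
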